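import Summits.AtomisticToContinuum.Crystallization.Theorems.FrustratedLawDichotomyTwoShellRigidityCapApriori

/-!
# FrustratedLawDichotomy · crux `AperiodicFrustratedLawGap` (stmt-AtomisticToContinuum-27623) — the TRILATERATION cap a-priori `Kq ≈ 2K + 4`
# (decomp-a2c, prover hand 1, gen 11; lens-5 g31 ASK «a trilateration lemma should give ≈ 2K + O(1)», critic rows 452 (b) / 456 (B) (β))

`FrustratedLawDichotomyTwoShellRigidityCapApriori` (p823350) proves lens-5's cap a-priori with `Kq = 54 + 2K` from the octahedral cell lemma.
This def-free file proves the SHARP version by trilateration from the four corners of the square: for `0 < θ ≤ 1/100`, `0 ≤ K`,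
`(K + 2 + θ)·θ ≤ 1/5` and `ε := (K + 2 + θ)·θ`: `‖(y m − y i) − nn_i·A(u+v)‖ ≤ (2ε + ε²)·nn_i`, i.e. `Kq = 2(K+2+θ) + (K+2+θ)²·θ`
(at `θ = 1/100`: `Kq(11) = 27.7 < 28`, `Kq(16) = 39.3 < 40`) — the body of lens-5's `CapAprioriAt Kq K θ Pat`
(`cap_apriori_trilateration_fcc / _hcp`); with lens-5's `fccBridge_of_coarse (K ≤ 18, Kq ≤ 40)` / `hcpBridge_of_coarse (K ≤ 12, Kq ≤ 28)` the
hand target of the M column at the literal becomes `R_fcc(K ≤ 16) ∧ R_hcp(K ≤ 11)` instead of `10 / 6`.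
GEOMETRY (`cap_trilateration_unit`, Theses-free, `E3`): ideal square `U, V, W, W'` (unit, `⟪U,V⟫ = ⟪W,W'⟫ = 0`, sides `1/2`, so
`W + W' = U + V`), `1 − ε ≤ ‖q − X‖ ≤ 1 + ε` at the four corners, `‖q‖ ≥ 1/2` (the centre `0` is the other equidistant point; the cap site is
`≠ i`) ⟹ `‖q − (U+V)‖ ≤ 2ε + ε²` (`ε ≤ 1/5`): with `P, Q, R` the inner products of `q` with `U, V, W`, `s = ‖q‖²`, dimension three gives
`s = ((P+Q)² + (P−Q)² + (2R−P−Q)²)/2`, the windows give `2X − s ∈ [−μ₂, μ₁]` (`μ₁,₂ = 2ε ∓ ε²`), and with `τ = P + Q − s` the concave quadratic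
`H(τ) = (1 − L² − τ)² + 2τ − 1 + 2(μ₁−τ)(τ+μ₂) = −(τ−τ₀)² + G(ε) ≤ 0` (`L = 2ε + ε²`, `G = −8ε³ + 16ε⁴ + 48ε⁵ + 44ε⁶ + 16ε⁷ + 2ε⁸ ≤ 0` on `[0, 1/5]`)
yields `|1 − L² − τ| ≤ |P + Q − 1|`; the branch `P + Q < 1` would give `s ≤ L² < 1/4` (excluded), the other `‖q − (U+V)‖² ≤ L²`.
`[folklore]` (elementary); def-free; no `sorry`.
-/
noncomputable section

namespace Summit.AtomisticToContinuum.Crystallization.Theorems.FrustratedLawDichotomyTwoShellRigidityCapTrilateration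

open Literature.Geometry.DiscreteGeometry
open Summit.AtomisticToContinuum.Crystallization.Theorems.FrustratedLawDichotomyTwoShellRigidityCut (E3 LinkIso Capped)
open Summit.AtomisticToContinuum.Crystallization.Theorems.FrustratedLawDichotomyTwoShellRigidityCells
  (ExtractionAt ne_and_dist_ne_one_of_dist_eq_sqrt_two)
open Summit.AtomisticToContinuum.Crystallization.Theorems.FrustratedLawDichotomyTwoShellRigidityExtraction
  (extractionAt_of_contactSeparating)
open Summit.AtomisticToContinuum.Crystallization.Theorems.FrustratedLawDichotomyTwoShellRigidityFrames (norm_sq_frame)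
open Summit.AtomisticToContinuum.Crystallization.Theorems.FrustratedLawDichotomyTwoShellRigidityTetraCell (inner_eq_half_of_unit)
open Summit.AtomisticToContinuum.Crystallization.Theorems.FrustratedLawDichotomyTwoShellRigidityOctaCell (frame_expand inner_eq_zero_of_unit)
open Summit.AtomisticToContinuum.Crystallization.Theorems.FrustratedLawDichotomyCappedRigidityCertPatterns
  (fcc_contactSeparating hcp_contactSeparating)
open Summit.AtomisticToContinuum.Crystallization.Theorems.FrustratedLawDichotomyTwoShellRigidityCapApriori
  (cap_bond_window fcc_exists_square_of_diagonal hcp_exists_square_of_diagonal)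
open scoped RealInnerProductSpace

/-! ### The arithmetic of the trilateration -/

/-- `G(ε) = −8ε³ + 16ε⁴ + 48ε⁵ + 44ε⁶ + 16ε⁷ + 2ε⁸ ≤ 0` on `[0, 1/5]` (the value of the concave quadratic at its vertex). [folklore] -/
theorem G_nonpos {ε : ℝ} (hε0 : 0 ≤ ε) (hε1 : ε ≤ 1 / 5) :
    -8 * ε ^ 3 + 16 * ε ^ 4 + 48 * ε ^ 5 + 44 * ε ^ 6 + 16 * ε ^ 7 + 2 * ε ^ 8 ≤ 0 := by
  have h3 : 0 ≤ ε ^ 3 := by positivity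
  have hb : -8 + 16 * ε + 48 * ε ^ 2 + 44 * ε ^ 3 + 16 * ε ^ 4 + 2 * ε ^ 5 ≤ 0 := by
    have e1 : ε ^ 2 ≤ (1 / 5) ^ 2 := pow_le_pow_left₀ hε0 hε1 2
    have e2 : ε ^ 3 ≤ (1 / 5) ^ 3 := pow_le_pow_left₀ hε0 hε1 3
    have e3 : ε ^ 4 ≤ (1 / 5) ^ 4 := pow_le_pow_left₀ hε0 hε1 4
    have e4 : ε ^ 5 ≤ (1 / 5) ^ 5 := pow_le_pow_left₀ hε0 hε1 5
    nlinarith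
  have key : -8 * ε ^ 3 + 16 * ε ^ 4 + 48 * ε ^ 5 + 44 * ε ^ 6 + 16 * ε ^ 7 + 2 * ε ^ 8 =
      ε ^ 3 * (-8 + 16 * ε + 48 * ε ^ 2 + 44 * ε ^ 3 + 16 * ε ^ 4 + 2 * ε ^ 5) := by ring
  rw [key]
  exact mul_nonpos_of_nonneg_of_nonpos h3 hb

/-- The concave quadratic: `H(τ) = (1 − (2ε+ε²)² − τ)² + 2τ − 1 + 2(2ε−ε²−τ)(τ+2ε+ε²) ≤ 0` for EVERY real `τ` (`0 ≤ ε ≤ 1/5`). [folklore] -/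
theorem H_nonpos {ε : ℝ} (hε0 : 0 ≤ ε) (hε1 : ε ≤ 1 / 5) (τ : ℝ) :
    (1 - (2 * ε + ε ^ 2) ^ 2 - τ) ^ 2 + 2 * τ - 1 + 2 * ((2 * ε - ε ^ 2) - τ) * (τ + (2 * ε + ε ^ 2)) ≤ 0 := by
  have hG := G_nonpos hε0 hε1
  have e : (1 - (2 * ε + ε ^ 2) ^ 2 - τ) ^ 2 + 2 * τ - 1 + 2 * ((2 * ε - ε ^ 2) - τ) * (τ + (2 * ε + ε ^ 2)) =
      -(τ - ((2 * ε + ε ^ 2) ^ 2 - 2 * ε ^ 2)) ^ 2 +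
        (-8 * ε ^ 3 + 16 * ε ^ 4 + 48 * ε ^ 5 + 44 * ε ^ 6 + 16 * ε ^ 7 + 2 * ε ^ 8) := by ring
  rw [e]
  linarith [sq_nonneg (τ - ((2 * ε + ε ^ 2) ^ 2 - 2 * ε ^ 2))]

/-- `δ² ≤ A·B` when `|δ| ≤ A` and `|δ| ≤ B` (given as four sign conditions). [folklore] -/
theorem sq_le_mul_of_bounds {A B δ : ℝ} (h1 : 0 ≤ A - δ) (h2 : 0 ≤ A + δ) (h3 : 0 ≤ B - δ) (h4 : 0 ≤ B + δ) :
    δ ^ 2 ≤ A * B := by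
  nlinarith [mul_nonneg h1 h4, mul_nonneg h2 h3]

/-- `(2ε + ε²)² < 1/4` for `0 ≤ ε ≤ 1/5`. [folklore] -/
theorem musq_lt {ε : ℝ} (hε0 : 0 ≤ ε) (hε1 : ε ≤ 1 / 5) : (2 * ε + ε ^ 2) ^ 2 < 1 / 4 := by
  have e1 : ε ^ 2 ≤ (1 / 5) ^ 2 := pow_le_pow_left₀ hε0 hε1 2
  have hL : 2 * ε + ε ^ 2 ≤ 11 / 25 := by linarith
  have hL0 : 0 ≤ 2 * ε + ε ^ 2 := by positivity
  have h := pow_le_pow_left₀ hL0 hL 2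
  have h' : ((11 : ℝ) / 25) ^ 2 < 1 / 4 := by norm_num
  exact lt_of_le_of_lt h h'

/-- **The trilateration arithmetic.**  `s = ‖q‖²`, `P, Q, R` the inner products of `q` with the corners `U, V, W` (the fourth is `P + Q − R`),
the dimension-three identity `s = ((P+Q)² + (P−Q)² + (2R−P−Q)²)/2`, the four windows and the exclusion `s ≥ 1/4` give
`‖q − (U+V)‖² = s − 2(P+Q) + 2 ≤ (2ε + ε²)²`. [folklore] -/
theorem trilat_arith {ε s P Q R : ℝ} (hε0 : 0 ≤ ε) (hε1 : ε ≤ 1 / 5)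
    (h3d : s = ((P + Q) ^ 2 + (P - Q) ^ 2 + (2 * R - P - Q) ^ 2) / 2)
    (hPl : (1 - ε) ^ 2 ≤ s - 2 * P + 1) (hPu : s - 2 * P + 1 ≤ (1 + ε) ^ 2)
    (hQl : (1 - ε) ^ 2 ≤ s - 2 * Q + 1) (hQu : s - 2 * Q + 1 ≤ (1 + ε) ^ 2)
    (hRl : (1 - ε) ^ 2 ≤ s - 2 * R + 1) (hRu : s - 2 * R + 1 ≤ (1 + ε) ^ 2)
    (hR'l : (1 - ε) ^ 2 ≤ s - 2 * (P + Q - R) + 1) (hR'u : s - 2 * (P + Q - R) + 1 ≤ (1 + ε) ^ 2)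
    (hfar : 1 / 4 ≤ s) : s - 2 * (P + Q) + 2 ≤ (2 * ε + ε ^ 2) ^ 2 := by
  have hL2 := musq_lt hε0 hε1
  have sq1 : (1 - ε) ^ 2 = 1 - 2 * ε + ε ^ 2 := by ring
  have sq2 : (1 + ε) ^ 2 = 1 + 2 * ε + ε ^ 2 := by ring
  obtain ⟨μ₁, hμ₁⟩ : ∃ μ₁ : ℝ, μ₁ = 2 * ε - ε ^ 2 := ⟨_, rfl⟩
  obtain ⟨μ₂, hμ₂⟩ : ∃ μ₂ : ℝ, μ₂ = 2 * ε + ε ^ 2 := ⟨_, rfl⟩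
  obtain ⟨τ, hτ⟩ : ∃ τ : ℝ, τ = P + Q - s := ⟨_, rfl⟩
  -- the four window quantities `2X - s ∈ [-μ₂, μ₁]`
  have hP1 : 2 * P - s ≤ μ₁ := by rw [hμ₁]; linarith
  have hP2 : -μ₂ ≤ 2 * P - s := by rw [hμ₂]; linarith
  have hQ1 : 2 * Q - s ≤ μ₁ := by rw [hμ₁]; linarith
  have hQ2 : -μ₂ ≤ 2 * Q - s := by rw [hμ₂]; linarith
  have hR1 : 2 * R - s ≤ μ₁ := by rw [hμ₁]; linarith
  have hR2 : -μ₂ ≤ 2 * R - s := by rw [hμ₂]; linarith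
  have hR'1 : 2 * (P + Q - R) - s ≤ μ₁ := by rw [hμ₁]; linarith
  have hR'2 : -μ₂ ≤ 2 * (P + Q - R) - s := by rw [hμ₂]; linarith
  -- δ₁² ≤ (μ₁ - τ)(τ + μ₂) and δ₂² ≤ (μ₁ - τ)(τ + μ₂)
  have hd1 : (P - Q) ^ 2 ≤ (μ₁ - τ) * (τ + μ₂) :=
    sq_le_mul_of_bounds (by rw [hτ]; linarith) (by rw [hτ]; linarith) (by rw [hτ]; linarith) (by rw [hτ]; linarith)
  have hd2 : (2 * R - P - Q) ^ 2 ≤ (μ₁ - τ) * (τ + μ₂) :=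
    sq_le_mul_of_bounds (by rw [hτ]; linarith) (by rw [hτ]; linarith) (by rw [hτ]; linarith) (by rw [hτ]; linarith)
  -- ρ² ≥ 1 - 2τ - 2AB for ρ = P + Q - 1 (dimension three)
  have hρ : 1 - 2 * τ - 2 * ((μ₁ - τ) * (τ + μ₂)) ≤ (P + Q - 1) ^ 2 := by
    have e : (P + Q - 1) ^ 2 = 1 - 2 * τ - (P - Q) ^ 2 - (2 * R - P - Q) ^ 2 := by
      rw [hτ, h3d]; ring
    rw [e]; linarith
  -- the concave quadratic
  have hH := H_nonpos hε0 hε1 τ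
  rw [← hμ₁, ← hμ₂] at hH
  have hc : (1 - μ₂ ^ 2 - τ) ^ 2 ≤ (P + Q - 1) ^ 2 := by linarith
  have habs : |1 - μ₂ ^ 2 - τ| ≤ |P + Q - 1| := sq_le_sq.1 hc
  rw [← hμ₂] at hL2
  have goal_eq : (2 * ε + ε ^ 2) ^ 2 = μ₂ ^ 2 := by rw [hμ₂]
  rw [goal_eq]
  rcases le_or_gt 0 (P + Q - 1) with hρ0 | hρ0
  · -- the near branch: the cap
    rw [abs_of_nonneg hρ0] at habs
    have h1 : 1 - μ₂ ^ 2 - τ ≤ P + Q - 1 := (le_abs_self _).trans habs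
    rw [hτ] at h1
    linarith
  · -- the far branch would put `q` within `L < 1/2` of the centre: excluded
    rw [abs_of_neg hρ0] at habs
    have h1 : 1 - μ₂ ^ 2 - τ ≤ -(P + Q - 1) := (le_abs_self _).trans habs
    rw [hτ] at h1
    exfalso
    linarith

/-! ### The geometry of the trilateration (Theses-free, `E3`) -/

/-- `‖x‖ = √2` from `‖x‖² = 2`. [folklore] -/
theorem norm_eq_sqrt_two_of_sq {x : E3} (h : ‖x‖ ^ 2 = 2) : ‖x‖ = Real.sqrt 2 := by
  rw [← Real.sqrt_sq (norm_nonneg x), h]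

/-- **Trilateration of the cap from the four corners of a unit square (scale `1`).**  `U, V, W, W'` unit vectors with `⟪U,V⟫ = ⟪W,W'⟫ = 0` and
the four sides `⟪U,W⟫ = ⟪V,W⟫ = ⟪U,W'⟫ = ⟪V,W'⟫ = 1/2`; `q` with `1 − ε ≤ ‖q − X‖ ≤ 1 + ε` for the four corners and `‖q‖ ≥ 1/2` (`0 ≤ ε ≤ 1/5`).
Then `‖q − (U + V)‖ ≤ 2ε + ε²`. [folklore] -/
theorem cap_trilateration_unit {U V W W' q : E3} {ε : ℝ} (hU : ‖U‖ = 1) (hV : ‖V‖ = 1) (hW : ‖W‖ = 1) (hW' : ‖W'‖ = 1)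
    (hUV : ⟪U, V⟫ = 0) (hUW : ⟪U, W⟫ = 1 / 2) (hVW : ⟪V, W⟫ = 1 / 2) (hUW' : ⟪U, W'⟫ = 1 / 2) (hVW' : ⟪V, W'⟫ = 1 / 2)
    (hWW' : ⟪W, W'⟫ = 0) (hε0 : 0 ≤ ε) (hε1 : ε ≤ 1 / 5)
    (hUl : 1 - ε ≤ ‖q - U‖) (hUu : ‖q - U‖ ≤ 1 + ε) (hVl : 1 - ε ≤ ‖q - V‖) (hVu : ‖q - V‖ ≤ 1 + ε)
    (hWl : 1 - ε ≤ ‖q - W‖) (hWu : ‖q - W‖ ≤ 1 + ε) (hW'l : 1 - ε ≤ ‖q - W'‖) (hW'u : ‖q - W'‖ ≤ 1 + ε)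
    (hfar : 1 / 2 ≤ ‖q‖) : ‖q - (U + V)‖ ≤ 2 * ε + ε ^ 2 := by
  -- ordered Gram data
  have hUU : ⟪U, U⟫ = 1 := by rw [real_inner_self_eq_norm_sq, hU, one_pow]
  have hVV : ⟪V, V⟫ = 1 := by rw [real_inner_self_eq_norm_sq, hV, one_pow]
  have hWWs : ⟪W, W⟫ = 1 := by rw [real_inner_self_eq_norm_sq, hW, one_pow]
  have hW'W's : ⟪W', W'⟫ = 1 := by rw [real_inner_self_eq_norm_sq, hW', one_pow]
  have hVU : ⟪V, U⟫ = 0 := (real_inner_comm U V).trans hUV; have hWU : ⟪W, U⟫ = 1 / 2 := (real_inner_comm U W).trans hUW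
  have hWV : ⟪W, V⟫ = 1 / 2 := (real_inner_comm V W).trans hVW; have hW'U : ⟪W', U⟫ = 1 / 2 := (real_inner_comm U W').trans hUW'
  have hW'V : ⟪W', V⟫ = 1 / 2 := (real_inner_comm V W').trans hVW'; have hW'W : ⟪W', W⟫ = 0 := (real_inner_comm W W').trans hWW'
  -- the fourth corner: `W' = U + V - W`
  have hW'eq : W' = U + V - W := by
    have h0 : ‖W' - (U + V - W)‖ ^ 2 = 0 := by
      rw [← real_inner_self_eq_norm_sq]
      simp only [inner_sub_left, inner_sub_right, inner_add_left, inner_add_right, hUU, hVV, hWWs, hW'W's, hUV, hVU, hUW, hWU,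
        hVW, hWV, hUW', hW'U, hVW', hW'V, hWW', hW'W]
      norm_num
    rwa [sq_eq_zero_iff, norm_eq_zero, sub_eq_zero] at h0
  -- the inner products of `q`
  obtain ⟨P, hP⟩ : ∃ P : ℝ, ⟪q, U⟫ = P := ⟨_, rfl⟩; obtain ⟨Q, hQ⟩ : ∃ Q : ℝ, ⟪q, V⟫ = Q := ⟨_, rfl⟩
  obtain ⟨R, hR⟩ : ∃ R : ℝ, ⟪q, W⟫ = R := ⟨_, rfl⟩; obtain ⟨s, hs⟩ : ∃ s : ℝ, ‖q‖ ^ 2 = s := ⟨_, rfl⟩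
  have hR' : ⟪q, W'⟫ = P + Q - R := by rw [hW'eq, inner_sub_right, inner_add_right, hP, hQ, hR]
  -- the orthonormal frame `(U+V, U−V, 2W−U−V)/√2` and the dimension-three identity
  obtain ⟨r, hr⟩ : ∃ r : ℝ, Real.sqrt 2 = r := ⟨_, rfl⟩
  have hr0 : 0 < r := by rw [← hr]; positivity
  have hr2 : r ^ 2 = 2 := by rw [← hr]; exact Real.sq_sqrt (by norm_num)
  have hri : r⁻¹ * r⁻¹ = 1 / 2 := by
    rw [← pow_two, inv_pow, hr2]; norm_num
  have n0 : ‖U + V‖ = r := by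
    rw [← hr]; apply norm_eq_sqrt_two_of_sq
    rw [← real_inner_self_eq_norm_sq, inner_add_left, inner_add_right, inner_add_right, hUU, hUV, hVU, hVV]; norm_num
  have n1 : ‖U - V‖ = r := by
    rw [← hr]; apply norm_eq_sqrt_two_of_sq
    rw [← real_inner_self_eq_norm_sq, inner_sub_left, inner_sub_right, inner_sub_right, hUU, hUV, hVU, hVV]; norm_num
  have n2 : ‖(2 : ℝ) • W - U - V‖ = r := by
    rw [← hr]; apply norm_eq_sqrt_two_of_sq
    rw [← real_inner_self_eq_norm_sq]
    simp only [inner_sub_left, inner_sub_right, real_inner_smul_left, real_inner_smul_right, hUU, hVV, hWWs, hUV, hVU, hUW,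
      hWU, hVW, hWV]
    norm_num
  have hnorm : ∀ x : E3, ‖x‖ = r → ‖r⁻¹ • x‖ = 1 := by
    intro x hx
    rw [norm_smul, Real.norm_eq_abs, abs_of_pos (inv_pos.2 hr0), hx, inv_mul_cancel₀ hr0.ne']
  have f0 : ‖r⁻¹ • (U + V)‖ = 1 := hnorm _ n0
  have f1 : ‖r⁻¹ • (U - V)‖ = 1 := hnorm _ n1
  have f2 : ‖r⁻¹ • ((2 : ℝ) • W - U - V)‖ = 1 := hnorm _ n2
  have o01 : ⟪r⁻¹ • (U + V), r⁻¹ • (U - V)⟫ = 0 := by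
    rw [real_inner_smul_left, real_inner_smul_right]
    simp only [inner_add_left, inner_sub_right, hUU, hUV, hVU, hVV]
    ring
  have o02 : ⟪r⁻¹ • (U + V), r⁻¹ • ((2 : ℝ) • W - U - V)⟫ = 0 := by
    rw [real_inner_smul_left, real_inner_smul_right]
    simp only [inner_add_left, inner_sub_right, real_inner_smul_right, hUU, hUV, hVU, hVV, hUW, hVW]
    ring
  have o12 : ⟪r⁻¹ • (U - V), r⁻¹ • ((2 : ℝ) • W - U - V)⟫ = 0 := by
    rw [real_inner_smul_left, real_inner_smul_right]
    simp only [inner_sub_left, inner_sub_right, real_inner_smul_right, hUU, hUV, hVU, hVV, hUW, hVW]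
    ring
  have c0 : ⟪q, r⁻¹ • (U + V)⟫ = r⁻¹ * (P + Q) := by
    rw [real_inner_smul_right, inner_add_right, hP, hQ]
  have c1 : ⟪q, r⁻¹ • (U - V)⟫ = r⁻¹ * (P - Q) := by
    rw [real_inner_smul_right, inner_sub_right, hP, hQ]
  have c2 : ⟪q, r⁻¹ • ((2 : ℝ) • W - U - V)⟫ = r⁻¹ * (2 * R - P - Q) := by
    rw [real_inner_smul_right, inner_sub_right, inner_sub_right, real_inner_smul_right, hP, hQ, hR]
  have h3d : s = ((P + Q) ^ 2 + (P - Q) ^ 2 + (2 * R - P - Q) ^ 2) / 2 := by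
    have hx := frame_expand f0 f1 f2 o01 o02 o12 q
    rw [c0, c1, c2] at hx
    have hn := norm_sq_frame f0 f1 f2 o01 o02 o12 (r⁻¹ * (P + Q)) (r⁻¹ * (P - Q)) (r⁻¹ * (2 * R - P - Q))
    rw [← hx, hs] at hn
    rw [hn]
    have e : ∀ a : ℝ, (r⁻¹ * a) ^ 2 = (r⁻¹ * r⁻¹) * a ^ 2 := fun a => by ring
    rw [e, e, e, hri]; ring
  -- the windows in inner-product form
  have hε' : 0 ≤ 1 - ε := by linarith
  have win : ∀ (X : E3) (c : ℝ), ‖X‖ = 1 → ⟪q, X⟫ = c → 1 - ε ≤ ‖q - X‖ → ‖q - X‖ ≤ 1 + ε →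
      (1 - ε) ^ 2 ≤ s - 2 * c + 1 ∧ s - 2 * c + 1 ≤ (1 + ε) ^ 2 := by
    intro X c hX hc hl hu
    have e : ‖q - X‖ ^ 2 = s - 2 * c + 1 := by rw [norm_sub_sq_real, hs, hc, hX, one_pow]
    rw [← e]
    exact ⟨pow_le_pow_left₀ hε' hl 2, pow_le_pow_left₀ (norm_nonneg _) hu 2⟩
  obtain ⟨hPl, hPu⟩ := win U P hU hP hUl hUu
  obtain ⟨hQl, hQu⟩ := win V Q hV hQ hVl hVu
  obtain ⟨hRl, hRu⟩ := win W R hW hR hWl hWu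
  obtain ⟨hR'l, hR'u⟩ := win W' (P + Q - R) hW' hR' hW'l hW'u
  have hfar' : 1 / 4 ≤ s := by
    have h := pow_le_pow_left₀ (by norm_num : (0 : ℝ) ≤ 1 / 2) hfar 2
    rw [← hs]; linarith
  have key := trilat_arith hε0 hε1 h3d hPl hPu hQl hQu hRl hRu hR'l hR'u hfar'
  -- back to the norm
  have e : ‖q - (U + V)‖ ^ 2 = s - 2 * (P + Q) + 2 := by
    rw [norm_sub_sq_real, hs, inner_add_right, hP, hQ, n0, hr2]
  have hL0 : 0 ≤ 2 * ε + ε ^ 2 := by positivity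
  exact (sq_le_sq₀ (norm_nonneg _) hL0).1 (by rw [e]; exact key)

/-- **Trilateration at scale `d > 0`**: windows `d(1−ε) ≤ ‖q − d·X‖ ≤ d(1+ε)` for the four corners and `‖q‖ ≥ d/2` give
`‖q − d·(U+V)‖ ≤ (2ε + ε²)·d`. [folklore] -/
theorem cap_trilateration {U V W W' q : E3} {ε d : ℝ} (hU : ‖U‖ = 1) (hV : ‖V‖ = 1) (hW : ‖W‖ = 1) (hW' : ‖W'‖ = 1)
    (hUV : ⟪U, V⟫ = 0) (hUW : ⟪U, W⟫ = 1 / 2) (hVW : ⟪V, W⟫ = 1 / 2) (hUW' : ⟪U, W'⟫ = 1 / 2) (hVW' : ⟪V, W'⟫ = 1 / 2)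
    (hWW' : ⟪W, W'⟫ = 0) (hε0 : 0 ≤ ε) (hε1 : ε ≤ 1 / 5) (hd : 0 < d)
    (hwin : ∀ X : E3, X = U ∨ X = V ∨ X = W ∨ X = W' → d * (1 - ε) ≤ ‖q - d • X‖ ∧ ‖q - d • X‖ ≤ d * (1 + ε))
    (hfar : d / 2 ≤ ‖q‖) : ‖q - d • (U + V)‖ ≤ (2 * ε + ε ^ 2) * d := by
  have hdi : 0 < d⁻¹ := inv_pos.2 hd
  have scale : ∀ X : E3, ‖d⁻¹ • q - X‖ = d⁻¹ * ‖q - d • X‖ := by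
    intro X
    have e : d⁻¹ • q - X = d⁻¹ • (q - d • X) := by
      rw [smul_sub, smul_smul, inv_mul_cancel₀ hd.ne', one_smul]
    rw [e, norm_smul, Real.norm_eq_abs, abs_of_pos hdi]
  have win : ∀ X : E3, X = U ∨ X = V ∨ X = W ∨ X = W' → 1 - ε ≤ ‖d⁻¹ • q - X‖ ∧ ‖d⁻¹ • q - X‖ ≤ 1 + ε := by
    intro X hX
    obtain ⟨h1, h2⟩ := hwin X hX
    rw [scale]
    constructor
    · rw [le_inv_mul_iff₀' hd]; linarith
    · rw [inv_mul_le_iff₀' hd]; linarith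
  obtain ⟨hUl, hUu⟩ := win U (Or.inl rfl)
  obtain ⟨hVl, hVu⟩ := win V (Or.inr (Or.inl rfl))
  obtain ⟨hWl, hWu⟩ := win W (Or.inr (Or.inr (Or.inl rfl)))
  obtain ⟨hW'l, hW'u⟩ := win W' (Or.inr (Or.inr (Or.inr rfl)))
  have hfar' : 1 / 2 ≤ ‖d⁻¹ • q‖ := by
    rw [norm_smul, Real.norm_eq_abs, abs_of_pos hdi, le_inv_mul_iff₀' hd]; linarith
  have h := cap_trilateration_unit hU hV hW hW' hUV hUW hVW hUW' hVW' hWW' hε0 hε1 hUl hUu hVl hVu hWl hWu hW'l hW'u hfar'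
  have e : ‖q - d • (U + V)‖ = d * ‖d⁻¹ • q - (U + V)‖ := by
    rw [scale, ← mul_assoc, mul_inv_cancel₀ hd.ne', one_mul]
  rw [e]
  nlinarith

/-! ### The cap a-priori by trilateration, in the tree's vocabulary -/

/-- Window arithmetic: `d/(1+θ) − Kθd ≥ d(1 − ε)` and `(1+θ)²d + Kθd = d(1+ε)` with `ε = (K + 2 + θ)θ`. [folklore] -/
theorem window_arith {K θ d : ℝ} (hθ0 : 0 < θ) (hK : 0 ≤ K) (hd : 0 < d) :
    d * (1 - (K + 2 + θ) * θ) ≤ d / (1 + θ) - K * θ * d ∧ (1 + θ) ^ 2 * d + K * θ * d = d * (1 + (K + 2 + θ) * θ) := by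
  refine ⟨?_, by ring⟩
  have hθ1 : 0 < 1 + θ := by linarith
  have hθd : 0 ≤ θ * d := by positivity
  have hθ2d : 0 ≤ θ ^ 2 * d := by positivity
  have hKθd : 0 ≤ K * θ * d := by positivity
  have h1 : d * (1 - θ) ≤ d / (1 + θ) := by
    rw [le_div_iff₀ hθ1]
    have e : d * (1 - θ) * (1 + θ) = d - θ ^ 2 * d := by ring
    rw [e]; linarith
  have e2 : d * (1 - (K + 2 + θ) * θ) = d - K * θ * d - 2 * (θ * d) - θ ^ 2 * d := by ring
  have e3 : d * (1 - θ) = d - θ * d := by ring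
  rw [e2]; rw [e3] at h1; linarith

/-- **THE CAP A-PRIORI BY TRILATERATION** (abstract pattern of unit vectors with `ExtractionAt θ` and the square fact): for `0 < θ ≤ 1/100`,
`0 ≤ K`, `(K + 2 + θ)θ ≤ 1/5`, every isometry `A` fitting the bonded dozen within `K·θ·nn_i`, every diagonal pair `u, v` and every `m ≠ i` bonded
to `τ` of the four vertices of the square: `‖(y m − y i) − nn_i·A(u+v)‖ ≤ (2(K+2+θ) + (K+2+θ)²θ)·θ·nn_i` — the BODY of lens-5's
`CapAprioriAt (2(K+2+θ) + (K+2+θ)²θ) K θ Pat`. [folklore] -/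
theorem cap_apriori_trilateration {K θ : ℝ} {Pat : Finset E3} (hθ0 : 0 < θ) (_hθ1 : θ ≤ 1 / 100) (hK : 0 ≤ K)
    (hKθ : (K + 2 + θ) * θ ≤ 1 / 5) (h1 : ∀ z ∈ Pat, ‖z‖ = 1) (hE : ExtractionAt θ Pat)
    (hsq : ∀ u v : ↥Pat, dist (u : E3) (v : E3) = Real.sqrt 2 → ∃ w w' : ↥Pat,
      dist (w : E3) (u : E3) = 1 ∧ dist (w : E3) (v : E3) = 1 ∧ dist (w' : E3) (u : E3) = 1 ∧ dist (w' : E3) (v : E3) = 1 ∧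
        dist (w : E3) (w' : E3) = Real.sqrt 2) :
    ∀ (N : ℕ) (y : Fin N → E3) (i : Fin N) (τ : ↥Pat → Fin N), Function.Injective y →
      (∀ a b : Fin N, a ≠ b → (7 : ℝ) / 10 ≤ dist (y a) (y b)) → LinkIso θ Pat y i τ → Capped θ Pat y i τ →
        ∀ A : E3 →ₗᵢ[ℝ] E3, (∀ u : ↥Pat, ‖(y (τ u) - y i) - nearestDist y i • A (u : E3)‖ ≤ K * θ * nearestDist y i) →
          ∀ (u v : ↥Pat) (m : Fin N), dist (u : E3) (v : E3) = Real.sqrt 2 → m ≠ i →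
            (∀ w : ↥Pat, (w = u ∨ w = v ∨ (dist (w : E3) (u : E3) = 1 ∧ dist (w : E3) (v : E3) = 1)) → (bondGraph θ y).Adj m (τ w)) →
              ‖(y m - y i) - nearestDist y i • A ((u : E3) + (v : E3))‖ ≤ (2 * (K + 2 + θ) + (K + 2 + θ) ^ 2 * θ) * θ * nearestDist y i := by
  intro N y i τ hy hsep hL hC A hA u v m huv hmi hb
  obtain ⟨hd, -, -, -, -⟩ := hE N y i τ hy hsep hL hC
  obtain ⟨w, w', hwu, hwv, hw'u, hw'v, hww'⟩ := hsq u v huv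
  -- Gram data of the ideal square `A u, A v, A w, A w'`
  have nu : ‖(u : E3)‖ = 1 := h1 _ u.2; have nv : ‖(v : E3)‖ = 1 := h1 _ v.2
  have nw : ‖(w : E3)‖ = 1 := h1 _ w.2; have nw' : ‖(w' : E3)‖ = 1 := h1 _ w'.2
  have hU : ‖A (u : E3)‖ = 1 := (A.norm_map _).trans nu; have hV : ‖A (v : E3)‖ = 1 := (A.norm_map _).trans nv
  have hW : ‖A (w : E3)‖ = 1 := (A.norm_map _).trans nw; have hW' : ‖A (w' : E3)‖ = 1 := (A.norm_map _).trans nw'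
  have hUV : ⟪A (u : E3), A (v : E3)⟫ = 0 := by rw [A.inner_map_map]; exact inner_eq_zero_of_unit nu nv huv
  have hWW' : ⟪A (w : E3), A (w' : E3)⟫ = 0 := by rw [A.inner_map_map]; exact inner_eq_zero_of_unit nw nw' hww'
  have hUW : ⟪A (u : E3), A (w : E3)⟫ = 1 / 2 := by
    rw [A.inner_map_map]; exact inner_eq_half_of_unit nu nw (by rw [dist_comm]; exact hwu)
  have hVW : ⟪A (v : E3), A (w : E3)⟫ = 1 / 2 := by
    rw [A.inner_map_map]; exact inner_eq_half_of_unit nv nw (by rw [dist_comm]; exact hwv)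
  have hUW' : ⟪A (u : E3), A (w' : E3)⟫ = 1 / 2 := by
    rw [A.inner_map_map]; exact inner_eq_half_of_unit nu nw' (by rw [dist_comm]; exact hw'u)
  have hVW' : ⟪A (v : E3), A (w' : E3)⟫ = 1 / 2 := by
    rw [A.inner_map_map]; exact inner_eq_half_of_unit nv nw' (by rw [dist_comm]; exact hw'v)
  -- the windows of the cap `q = y m − y i` relative to the ideal corners `nn_i • A x`
  have key' : ∀ z : ↥Pat, (z = u ∨ z = v ∨ z = w ∨ z = w') →
      (z = u ∨ z = v ∨ (dist (z : E3) (u : E3) = 1 ∧ dist (z : E3) (v : E3) = 1)) := by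
    rintro z (rfl | rfl | rfl | rfl)
    exacts [Or.inl rfl, Or.inr (Or.inl rfl), Or.inr (Or.inr ⟨hwu, hwv⟩), Or.inr (Or.inr ⟨hw'u, hw'v⟩)]
  obtain ⟨hlo, hhi⟩ := window_arith (d := nearestDist y i) hθ0 hK hd
  have hε0 : 0 ≤ (K + 2 + θ) * θ := by positivity
  have hwin : ∀ z : ↥Pat, (z = u ∨ z = v ∨ z = w ∨ z = w') →
      nearestDist y i * (1 - (K + 2 + θ) * θ) ≤ ‖(y m - y i) - nearestDist y i • A (z : E3)‖ ∧
        ‖(y m - y i) - nearestDist y i • A (z : E3)‖ ≤ nearestDist y i * (1 + (K + 2 + θ) * θ) := by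
    intro z hz
    obtain ⟨c1, c2⟩ := cap_bond_window hθ0.le (hL.1 z) (hb z (key' z hz))
    rw [dist_eq_norm] at c1 c2
    have hAz := hA z
    have tri1 : ‖(y m - y i) - nearestDist y i • A (z : E3)‖ ≤
        ‖(y m - y i) - (y (τ z) - y i)‖ + ‖(y (τ z) - y i) - nearestDist y i • A (z : E3)‖ := norm_sub_le_norm_sub_add_norm_sub _ _ _
    have tri2 : ‖(y m - y i) - (y (τ z) - y i)‖ ≤
        ‖(y m - y i) - nearestDist y i • A (z : E3)‖ + ‖(y (τ z) - y i) - nearestDist y i • A (z : E3)‖ := by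
      have h := norm_sub_le_norm_sub_add_norm_sub (y m - y i) (nearestDist y i • A (z : E3)) (y (τ z) - y i)
      rw [norm_sub_rev (nearestDist y i • A (z : E3))] at h
      exact h
    constructor <;> linarith
  have U_win : ∀ X : E3, X = A (u : E3) ∨ X = A (v : E3) ∨ X = A (w : E3) ∨ X = A (w' : E3) →
      nearestDist y i * (1 - (K + 2 + θ) * θ) ≤ ‖(y m - y i) - nearestDist y i • X‖ ∧
        ‖(y m - y i) - nearestDist y i • X‖ ≤ nearestDist y i * (1 + (K + 2 + θ) * θ) := by
    rintro X (rfl | rfl | rfl | rfl)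
    exacts [hwin u (Or.inl rfl), hwin v (Or.inr (Or.inl rfl)), hwin w (Or.inr (Or.inr (Or.inl rfl))),
      hwin w' (Or.inr (Or.inr (Or.inr rfl)))]
  have hfar : nearestDist y i / 2 ≤ ‖y m - y i‖ := by
    have h1 : nearestDist y i ≤ ‖y m - y i‖ := by
      rw [← dist_eq_norm, dist_comm]; exact nearestDist_le_dist y hmi
    linarith
  have h := cap_trilateration hU hV hW hW' hUV hUW hVW hUW' hVW' hWW' hε0 hKθ hd U_win hfar
  rw [← map_add] at h
  have e : (2 * ((K + 2 + θ) * θ) + ((K + 2 + θ) * θ) ^ 2) * nearestDist y i =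
      (2 * (K + 2 + θ) + (K + 2 + θ) ^ 2 * θ) * θ * nearestDist y i := by ring
  rw [e] at h
  exact h

/-- **THE TRILATERATION CAP A-PRIORI, fcc** (`0 < θ ≤ 1/100`, `0 ≤ K`, `(K+2+θ)θ ≤ 1/5`): the body of lens-5's
`CapAprioriAt (2(K+2+θ) + (K+2+θ)²θ) K θ fccKissingPattern`; at `θ = 1/100`: `Kq(16) = 39.26 ≤ 40` (lens-5's `fccBridge_of_coarse`). [folklore] -/
theorem cap_apriori_trilateration_fcc {K θ : ℝ} (hθ0 : 0 < θ) (hθ1 : θ ≤ 1 / 100) (hK : 0 ≤ K) (hKθ : (K + 2 + θ) * θ ≤ 1 / 5) :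
    ∀ (N : ℕ) (y : Fin N → E3) (i : Fin N) (τ : ↥fccKissingPattern → Fin N), Function.Injective y →
      (∀ a b : Fin N, a ≠ b → (7 : ℝ) / 10 ≤ dist (y a) (y b)) → LinkIso θ fccKissingPattern y i τ → Capped θ fccKissingPattern y i τ →
        ∀ A : E3 →ₗᵢ[ℝ] E3, (∀ u : ↥fccKissingPattern, ‖(y (τ u) - y i) - nearestDist y i • A (u : E3)‖ ≤ K * θ * nearestDist y i) →
          ∀ (u v : ↥fccKissingPattern) (m : Fin N), dist (u : E3) (v : E3) = Real.sqrt 2 → m ≠ i →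
            (∀ w : ↥fccKissingPattern, (w = u ∨ w = v ∨ (dist (w : E3) (u : E3) = 1 ∧ dist (w : E3) (v : E3) = 1)) → (bondGraph θ y).Adj m (τ w)) →
              ‖(y m - y i) - nearestDist y i • A ((u : E3) + (v : E3))‖ ≤ (2 * (K + 2 + θ) + (K + 2 + θ) ^ 2 * θ) * θ * nearestDist y i :=
  have hf : fccKissingPattern.Nonempty := Finset.card_pos.1 (by rw [card_fccKissingPattern]; norm_num)
  cap_apriori_trilateration hθ0 hθ1 hK hKθ (fun _ hz => norm_eq_one_of_mem_fccKissingPattern hz)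
    (extractionAt_of_contactSeparating hθ0.le hf fcc_contactSeparating) fcc_exists_square_of_diagonal

/-- **THE TRILATERATION CAP A-PRIORI, hcp**: the body of lens-5's `CapAprioriAt (2(K+2+θ) + (K+2+θ)²θ) K θ hcpKissingPattern`; at
`θ = 1/100`: `Kq(11) = 27.71 ≤ 28` (lens-5's `hcpBridge_of_coarse`). [folklore] -/
theorem cap_apriori_trilateration_hcp {K θ : ℝ} (hθ0 : 0 < θ) (hθ1 : θ ≤ 1 / 100) (hK : 0 ≤ K) (hKθ : (K + 2 + θ) * θ ≤ 1 / 5) :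
    ∀ (N : ℕ) (y : Fin N → E3) (i : Fin N) (τ : ↥hcpKissingPattern → Fin N), Function.Injective y →
      (∀ a b : Fin N, a ≠ b → (7 : ℝ) / 10 ≤ dist (y a) (y b)) → LinkIso θ hcpKissingPattern y i τ → Capped θ hcpKissingPattern y i τ →
        ∀ A : E3 →ₗᵢ[ℝ] E3, (∀ u : ↥hcpKissingPattern, ‖(y (τ u) - y i) - nearestDist y i • A (u : E3)‖ ≤ K * θ * nearestDist y i) →
          ∀ (u v : ↥hcpKissingPattern) (m : Fin N), dist (u : E3) (v : E3) = Real.sqrt 2 → m ≠ i →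
            (∀ w : ↥hcpKissingPattern, (w = u ∨ w = v ∨ (dist (w : E3) (u : E3) = 1 ∧ dist (w : E3) (v : E3) = 1)) → (bondGraph θ y).Adj m (τ w)) →
              ‖(y m - y i) - nearestDist y i • A ((u : E3) + (v : E3))‖ ≤ (2 * (K + 2 + θ) + (K + 2 + θ) ^ 2 * θ) * θ * nearestDist y i :=
  have hh : hcpKissingPattern.Nonempty := Finset.card_pos.1 (by rw [card_hcpKissingPattern]; norm_num)
  cap_apriori_trilateration hθ0 hθ1 hK hKθ (fun _ hz => norm_eq_one_of_mem_hcpKissingPattern hz)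
    (extractionAt_of_contactSeparating hθ0.le hh hcp_contactSeparating) hcp_exists_square_of_diagonal

end Summit.AtomisticToContinuum.Crystallization.Theorems.FrustratedLawDichotomyTwoShellRigidityCapTrilateration

end
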